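import Literature.ModelTheory.ExponentialFields.OMinimalCellDecomposition
import Literature.ModelTheory.ExponentialFields.OMinimalOfModelComplete
import HarnessLib

/-!
# O-minimality is preserved under elementary equivalence (Knight–Pillay–Steinhorn)

Topic `Literature/ModelTheory/ExponentialFields`.  J. Knight, A. Pillay, C. Steinhorn,
*Definable sets in ordered structures II*, Trans. AMS 295 (1986) 593–605, Theorem 0.2: **if `M`
is an o-minimal structure and `N ≡ M`, then `N` is o-minimal** (so "strongly o-minimal" =
"o-minimal"); equivalently (Theorem 0.3 there; van den Dries 1998, Ch. 3, (2.13) with the remark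
(2.10) of Ch. 1 that uniform finiteness makes o-minimality a first-order property of the theory)
every model of the complete theory of an o-minimal structure is o-minimal.

Proof (for `M` densely ordered without endpoints, the case of van den Dries' Ch. 3; Knight–
Pillay–Steinhorn treat arbitrary o-minimal `M`): for a formula `φ(c̄, x)`, uniform finiteness
(`CellDecomposition.uniformFiniteness_isBd`, `OMinimalCellDecomposition.lean`) bounds the number
of boundary points of the sections `φ(c̄, M)` by some `N` independent of `c̄`; membership in a
section only depends on the position relative to its boundary points
(`mem_iff_of_sameCell_of_isBd`), so `M` satisfies the *cell sentence*
`∀ c̄ ∃ b₁ … b_N ∀ x x' (SameCell(b̄; x, x') → (φ(c̄, x) ↔ φ(c̄, x')))` of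
`OMinimalOfModelComplete.lean` (`models_cellSentence_of_isOMinimal`); the sentence transfers to
`N`, where it makes every section a finite union of points and intervals
(`OMinimalOfModelComplete.isOMinimal_of_models_cellSentence`).

* `isOMinimal_of_elementarilyEquivalent` — **KPS, Theorem 0.2**;
* `isOMinimal_of_model_completeTheory`, `isOMinimal_completeTheory` — every model of `Th(M)` is
  o-minimal (`Theory.IsOMinimal` of `ModelTheoryPreds.lean`);
* `isOMinimal_realExpModel_of_isOMinimal_real`, `isOMinimal_realExpTheory_of_isOMinimal_real` —
  in particular, granting the o-minimality of `ℝ_exp` (`wilkie_isOMinimal`), every model of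
  `T_exp` is o-minimal; likewise `isOMinimal_realOrderedFieldTheory_of_isOMinimal_real` for
  `Th(ℝ; +, ·, -, 0, 1, ≤)` from Tarski's theorem (`real_isOMinimal`).

Nothing here is a named fact.

## References

* [KnightPillaySteinhorn1986] J. Knight, A. Pillay, C. Steinhorn, *Definable sets in ordered
  structures II*, Trans. AMS 295 (1986) 593–605, Theorems 0.2, 0.3.
* [Dries1998] L. van den Dries, *Tame topology and o-minimal structures*, CUP 1998, Ch. 3,
  (2.13); Ch. 1, (2.10).
* [PillaySteinhorn1986] A. Pillay, C. Steinhorn, *Definable sets in ordered structures I*,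
  Trans. AMS 295 (1986) 565–592, Def. 1.1.
-/

open Set FirstOrder FirstOrder.Language

namespace Literature.ModelTheory.ExponentialFields

namespace OMinimalElementary

open OMinimalOfModelComplete CellDecomposition

universe u v

variable {L : FirstOrder.Language.{u, v}}

/-- A finite subset with at most `N` elements of a non-empty type is contained in the range of an
`N`-tuple. [folklore] -/
theorem exists_range_superset_of_ncard_le {α : Type*} [Nonempty α] {F : Set α} (hF : F.Finite)
    {N : ℕ} (hN : F.ncard ≤ N) : ∃ b : Fin N → α, F ⊆ Set.range b := by
  classical
  obtain ⟨d⟩ := ‹Nonempty α›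
  have hle : hF.toFinset.card ≤ N := by rwa [← Set.ncard_eq_toFinset_card F hF]
  let e := hF.toFinset.equivFin
  refine ⟨fun i => if h : (i : ℕ) < hF.toFinset.card then (e.symm ⟨i, h⟩ : α) else d,
    fun z hz => ?_⟩
  have hz' : z ∈ hF.toFinset := hF.mem_toFinset.2 hz
  refine ⟨⟨e ⟨z, hz'⟩, lt_of_lt_of_le (e ⟨z, hz'⟩).2 hle⟩, ?_⟩
  have hlt : ((e ⟨z, hz'⟩ : Fin hF.toFinset.card) : ℕ) < hF.toFinset.card := (e ⟨z, hz'⟩).2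
  simp only [hlt, ↓reduceDIte, Fin.eta, Equiv.symm_apply_apply]

/-- **Membership in a definable subset of the line only depends on the cell of its boundary
points** (o-minimal structure on a dense linear order without endpoints, `<` definable): if all
boundary points of `S` are among the cut points `b̄` and `x`, `x'` have the same position
relative to every `bᵢ`, then `x ∈ S ↔ x' ∈ S` — between a point of `S` and a point outside lies a
boundary point (`CellDecomposition.exists_isBd_between`), which would be a `bᵢ` separating `x`
from `x'`. [cite: Dries1998, Ch. 1 (3.3)] -/
theorem mem_iff_of_sameCell_of_isBd {M : Type*} [L.Structure M] [LinearOrder M]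
    [DenselyOrdered M] [NoMinOrder M] [NoMaxOrder M] (hO : L.IsOMinimal M)
    (hlt : (univ : Set M).Definable L {v : Fin 2 → M | v 0 < v 1})
    {S : Set M} (hS : (univ : Set M).Definable₁ L S) {N : ℕ} (b : Fin N → M)
    (hb : {r | IsBd S r} ⊆ Set.range b) {x x' : M} (h : SameCell b x x') :
    x ∈ S ↔ x' ∈ S := by
  have key : ∀ {x x' : M}, SameCell b x x' → x ∈ S → x' ∈ S := by
    intro x x' h hx
    by_contra hx'
    obtain ⟨c, hc1, hc2, hcBd⟩ := exists_isBd_between hO hlt hS hx hx'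
    obtain ⟨i, hi⟩ := hb hcBd
    obtain ⟨h1, h2⟩ := h i
    rw [hi] at h1 h2
    rcases le_total x x' with hle | hle
    · rw [min_eq_left hle] at hc1
      rw [max_eq_right hle] at hc2
      have hx'le : x' ≤ c := h1.1 hc1
      have hxge : c ≤ x := h2.2 hc2
      exact hx' (le_antisymm hle (hx'le.trans hxge) ▸ hx)
    · rw [min_eq_right hle] at hc1
      rw [max_eq_left hle] at hc2
      have hxle : x ≤ c := h1.2 hc1
      have hx'ge : c ≤ x' := h2.1 hc2
      exact hx' (le_antisymm (hxle.trans hx'ge) hle ▸ hx)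
  have hsymm : SameCell b x' x := fun i => ⟨(h i).1.symm, (h i).2.symm⟩
  exact ⟨key h, key hsymm⟩

/-- **An o-minimal structure satisfies the cell sentences** (the `M`-side of
Knight–Pillay–Steinhorn 1986, Theorem 0.3 / van den Dries 1998, Ch. 3, (2.13)): for every formula
`φ(c̄, x)` there is `N` such that for all `c̄` some `N` cut points determine the section
`φ(c̄, M)` — by uniform finiteness of the boundaries of the sections.  `M` densely ordered
without endpoints, `≤` a symbol of `L` interpreted as the order.
[cite: KnightPillaySteinhorn1986, Theorem 0.3] -/
theorem models_cellSentence_of_isOMinimal {M : Type*} [L.Structure M] [LinearOrder M]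
    [DenselyOrdered M] [NoMinOrder M] [NoMaxOrder M] [Nonempty M] [L.IsOrdered]
    [L.OrderedStructure M] (hO : L.IsOMinimal M) {p : ℕ} (φ : L.Formula (Fin p ⊕ Fin 1)) :
    ∃ N : ℕ, M ⊨ cellSentence φ N := by
  classical
  letI : TopologicalSpace M := Preorder.topology M
  haveI : OrderTopology M := ⟨rfl⟩
  have hlt : (univ : Set M).Definable L {v : Fin 2 → M | v 0 < v 1} :=
    definable_lt_of_orderedStructure
  -- the family of sections as a definable subset of `M^{p+1}`
  set S : Set (Fin (p + 1) → M) :=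
    {v | φ.Realize (Sum.elim (Fin.init v) fun _ => v (Fin.last p))} with hSdef
  have hS : (univ : Set M).Definable L S := by
    refine Set.Definable.mono ?_ (empty_subset _)
    rw [Set.empty_definable_iff]
    refine ⟨φ.relabel (Sum.elim Fin.castSucc fun _ => Fin.last p), ?_⟩
    ext v
    simp only [hSdef, mem_setOf_eq, Formula.realize_relabel]
    refine iff_of_eq (congrArg φ.Realize ?_)
    funext z
    rcases z with z | z <;> rfl
  obtain ⟨N, hN⟩ := uniformFiniteness_isBd hO hlt S hS
  refine ⟨N, (realize_cellSentence M φ N).2 fun c => ?_⟩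
  obtain ⟨hfin, hle⟩ := hN c
  have hfib : {t | (Fin.snoc c t : Fin (p + 1) → M) ∈ S} =
      {t | φ.Realize (Sum.elim c fun _ => t)} := by
    ext t
    simp only [hSdef, mem_setOf_eq, Fin.init_snoc, Fin.snoc_last]
  rw [hfib] at hfin hle
  obtain ⟨b, hb⟩ := exists_range_superset_of_ncard_le hfin hle
  -- the section at `c` is definable
  have hmap : (univ : Set M).DefinableMap L
      (fun v : Fin 1 → M => (Fin.snoc c (v 0) : Fin (p + 1) → M)) := by
    intro i
    refine Fin.lastCases ?_ (fun j => ?_) i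
    · simp only [Fin.snoc_last]
      exact definableFun_proj _
    · simp only [Fin.snoc_castSucc]
      exact definableFun_const' _ (c j)
  have hSc : (univ : Set M).Definable₁ L {t | φ.Realize (Sum.elim c fun _ => t)} := by
    show (univ : Set M).Definable L {v : Fin 1 → M | φ.Realize (Sum.elim c fun _ => v 0)}
    have h := hS.preimage_map hmap
    refine (congrArg _ ?_).mpr h
    ext v
    simp only [mem_setOf_eq, mem_preimage, hSdef, Fin.init_snoc, Fin.snoc_last]
  exact ⟨b, fun x x' hxx' => mem_iff_of_sameCell_of_isBd hO hlt hSc b hb hxx'⟩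

/-- **Knight–Pillay–Steinhorn 1986, Theorem 0.2: o-minimality is preserved under elementary
equivalence.**  If `M` is an o-minimal `L`-structure on a dense linear order without endpoints
(`≤` a symbol of `L` interpreted as the order) and `N` is an ordered `L`-structure elementarily
equivalent to `M`, then `N` is o-minimal. [cite: KnightPillaySteinhorn1986, Theorem 0.2] -/
theorem isOMinimal_of_elementarilyEquivalent [L.IsOrdered] {M : Type*} [L.Structure M]
    [LinearOrder M] [DenselyOrdered M] [NoMinOrder M] [NoMaxOrder M] [Nonempty M]
    [L.OrderedStructure M] {N : Type*} [L.Structure N] [LinearOrder N] [L.OrderedStructure N]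
    [Nonempty N] (h : M ≅[L] N) (hO : L.IsOMinimal M) : L.IsOMinimal N := by
  refine isOMinimal_of_models_cellSentence fun p φ => ?_
  obtain ⟨K, hK⟩ := models_cellSentence_of_isOMinimal hO φ
  exact ⟨K, (elementarilyEquivalent_iff.1 h _).1 hK⟩

/-- **Every model of the complete theory of an o-minimal structure is o-minimal**
(Knight–Pillay–Steinhorn 1986, Theorem 0.3; `M` densely ordered without endpoints).
[cite: KnightPillaySteinhorn1986, Theorem 0.3] -/
theorem isOMinimal_of_model_completeTheory [L.IsOrdered] {M : Type*} [L.Structure M]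
    [LinearOrder M] [DenselyOrdered M] [NoMinOrder M] [NoMaxOrder M] [Nonempty M]
    [L.OrderedStructure M] (hO : L.IsOMinimal M) (N : Type*) [L.Structure N] [LinearOrder N]
    [L.OrderedStructure N] [Nonempty N] [N ⊨ L.completeTheory M] : L.IsOMinimal N := by
  refine isOMinimal_of_models_cellSentence fun p φ => ?_
  obtain ⟨K, hK⟩ := models_cellSentence_of_isOMinimal hO φ
  exact ⟨K, (realize_iff_of_model_completeTheory M N _).2 hK⟩

/-- **The complete theory of an o-minimal structure is o-minimal** (Knight–Pillay–Steinhorn 1986,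
Theorem 0.3), in the sense of `FirstOrder.Language.Theory.IsOMinimal` (`ModelTheoryPreds.lean`:
every model, with `≤` read as the order, is an o-minimal structure); `M` densely ordered without
endpoints. [cite: KnightPillaySteinhorn1986, Theorem 0.3] -/
theorem isOMinimal_completeTheory [L.IsOrdered] {M : Type*} [L.Structure M] [LinearOrder M]
    [DenselyOrdered M] [NoMinOrder M] [NoMaxOrder M] [Nonempty M] [L.OrderedStructure M]
    (hO : L.IsOMinimal M) : (L.completeTheory M).IsOMinimal := fun N _ _ =>
  isOMinimal_of_model_completeTheory hO N

end OMinimalElementary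

/-! ### Models of `T_exp` -/

/-- **If `ℝ_exp` is o-minimal then so is every model of `T_exp = Th(ℝ_exp)`** (Knight–Pillay–
Steinhorn 1986, Theorem 0.2, applied to Wilkie's theorem `wilkie_isOMinimal`, here a hypothesis).
[cite: KnightPillaySteinhorn1986, Theorem 0.2] -/
theorem isOMinimal_realExpModel_of_isOMinimal_real (hO : Language.orderedExpRing.IsOMinimal ℝ)
    (K : Language.Theory.ModelType.{0, 0, 0} realExpTheory) :
    Language.orderedExpRing.IsOMinimal K :=
  haveI : (K : Type) ⊨ Language.orderedExpRing.completeTheory ℝ :=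
    (inferInstance : (K : Type) ⊨ realExpTheory)
  OMinimalElementary.isOMinimal_of_model_completeTheory (L := Language.orderedExpRing) (M := ℝ)
    hO K

/-- **If `ℝ_exp` is o-minimal then `T_exp` is an o-minimal theory** (`Theory.IsOMinimal`: every
model, however `≤` is read as a linear order, is o-minimal; Knight–Pillay–Steinhorn 1986,
Theorem 0.3). [cite: KnightPillaySteinhorn1986, Theorem 0.3] -/
theorem isOMinimal_realExpTheory_of_isOMinimal_real
    (hO : Language.orderedExpRing.IsOMinimal ℝ) : realExpTheory.IsOMinimal :=
  OMinimalElementary.isOMinimal_completeTheory (L := Language.orderedExpRing) (M := ℝ) hO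

/-- **If the real ordered field is o-minimal (Tarski) then `Th(ℝ; +, ·, -, 0, 1, ≤)` is an
o-minimal theory**: every real closed field elementarily equivalent to `ℝ` is o-minimal
(Knight–Pillay–Steinhorn 1986, Theorem 0.3). [cite: KnightPillaySteinhorn1986, Theorem 0.3] -/
theorem isOMinimal_realOrderedFieldTheory_of_isOMinimal_real
    (hO : Language.orderedRing.IsOMinimal ℝ) : realOrderedFieldTheory.IsOMinimal :=
  OMinimalElementary.isOMinimal_completeTheory (L := Language.orderedRing) (M := ℝ) hO

end Literature.ModelTheory.ExponentialFields
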